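import Mathlib.RepresentationTheory.Character
import HarnessLib

/-!
# Venture HSemireg — the HEISENBERG COUNT: characters vanish off the centre, so a level subgroup of order `m`
# sees exactly `dim V / m` invariants (TRIAGE RULE TW (R-CT), the «χ/|G|» of the twisted / free-symmetric census rows)

HONEST FRAMING. Lean index of the computation cell `pub-hsemireg`, widening seat `w1-tw-1` (W1, «twisted sheaves on
gerbes over the CM anchors»); companion of `EquivariantSigmaInvariants.lean` (kernel law) and
`EquivariantInvariantsExact.lean` (exactness of invariants). ELEMENTARY CHARACTER THEORY of finite groups over a field in
which the group order is invertible (folklore; the abstract half of the Stone–von Neumann–Mumford theorem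
[Mumford1966EquationsI, §1 Prop. 3]). No theta group, no line bundle, no cohomology group and no semiregularity map is
constructed here; nothing here says that HC, HC_CM or HC_AV holds, and nothing here is a new case of anything.

*What it indexes (on paper, NOT in this file).* In the seat note `widen/W1/TW-EQ-w1tw1.md` §11 (TRIAGE RULE TW) and
`widen/W1/PLAN-W1-TW.md` T-9, a census verdict carried only by a COUNT («`dim Ext²(N,N)` exceeds the target budget») must,
for a design `N` with a FREE translation symmetry `G ⊂ A[n]` (equivalently: for its twisted descent), be re-read with the
INVARIANT count `dim Ext²(N,N)^G`. For slot-product line-bundle designs the blocks of `Ext²` are cohomology groups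
`H^{i(M)}(A, M)` of non-degenerate line bundles `M = L_y ⊗ L_x^{-1}`, on which Mumford's theta group `𝒢(M)` acts with
central weight `1` and `G` acts through a LEVEL subgroup (an isotropic lift, [Mumford1966EquationsI, §1]); non-degeneracy of
the commutator pairing `e^M` (loc. cit. Th. 1) gives every `g ∈ G ∖ 0` a partner `h ∈ 𝒢(M)` with
`h g h⁻¹ = e^M(g,h) · g`, `e^M(g,h) ≠ 1`. The two facts recorded below then say: the character of `g ≠ 0` on `H^{i(M)}(M)`
VANISHES, hence `|G| · dim H^{i(M)}(M)^G = dim H^{i(M)}(M) = |χ(M)|` — the «`χ/|G|`» bookkeeping of the family-B census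
(`target-g6/DETTWIST-G6-t12.md` §1.1 «Ext^k(B̄,B̄) = Ext^k(E,E)^G, χ/|G|») and of T-9, for every free symmetric descent /
every Brauer twist (THEOREM TW-EQ).

CONTENT (all PROVED, 0 sorry, no definitions, no named facts), namespace `Summit.Ventures.HSemireg.HeisenbergCount`,
for a representation `ρ : Representation k G V` of a group `G` on a finite-dimensional space over a field `k`:
* `character_eq_zero_of_conj_eq_smul` — if some conjugate acts as `ρ (h g h⁻¹) = ζ • ρ g` with `ζ ≠ 1`, then
  `ρ.character g = 0` (trace is conjugation invariant);
* `character_eq_zero_of_commutator_eq_smul_one` — the Heisenberg form: if the commutator `h g h⁻¹ g⁻¹` acts by a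
  scalar `ζ ≠ 1`, then `ρ.character g = 0`;
* `card_mul_finrank_invariants_eq` (+ `_nat` form in characteristic `0`) — **if the character vanishes off the identity,
  then `|G| · dim V^G = dim V`** (from Mathlib's `card_inv_mul_sum_char_eq_finrank`, the trace of the Reynolds projector);
* `card_mul_finrank_invariants_comp_subtype_eq` (+ `_nat`) — **LEVEL-SUBGROUP COUNT**: for a subgroup `K ≤ G` every
  non-trivial element of which has a Heisenberg partner in `G`, `|K| · dim V^K = dim V`.
-/

noncomputable section

open Representation Module

namespace Summit.Ventures.HSemireg

namespace HeisenbergCount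

variable {G k V : Type*} [Group G] [Field k] [AddCommGroup V] [Module k V]
variable (ρ : Representation k G V)

/-- **Trace vanishing from a twisted conjugate.** If `ρ (h g h⁻¹) = ζ • ρ g` with `ζ ≠ 1`, then the character of `ρ`
at `g` is `0` (the trace is invariant under conjugation, so `χ(g) = ζ χ(g)`). Folklore. -/
theorem character_eq_zero_of_conj_eq_smul {g h : G} {ζ : k} (hζ : ζ ≠ 1)
    (hz : ρ (h * g * h⁻¹) = ζ • ρ g) : ρ.character g = 0 := by
  have h1 : ρ.character (h * g * h⁻¹) = ζ * ρ.character g := by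
    simp only [Representation.character, hz, map_smul, smul_eq_mul]
  rw [Representation.char_conj] at h1
  have h2 : (1 - ζ) * ρ.character g = 0 := by
    rw [sub_mul, one_mul, ← h1, sub_self]
  rcases mul_eq_zero.mp h2 with h0 | h0
  · exact absurd (sub_eq_zero.mp h0).symm hζ
  · exact h0

/-- **Heisenberg form.** If the commutator `h g h⁻¹ g⁻¹` acts on `V` by a scalar `ζ ≠ 1` (a central element of
non-trivial weight, as in a theta group with its tautological central character), then `ρ.character g = 0`: the
character of a weight-`1` representation of a Heisenberg group VANISHES OFF THE CENTRE. Folklore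
([Mumford1966EquationsI, §1], proof of Prop. 3). -/
theorem character_eq_zero_of_commutator_eq_smul_one {g h : G} {ζ : k} (hζ : ζ ≠ 1)
    (hz : ρ (h * g * h⁻¹ * g⁻¹) = ζ • (1 : V →ₗ[k] V)) : ρ.character g = 0 := by
  apply character_eq_zero_of_conj_eq_smul ρ hζ (h := h)
  have : ρ (h * g * h⁻¹) = ρ (h * g * h⁻¹ * g⁻¹) * ρ g := by
    rw [← map_mul, inv_mul_cancel_right]
  rw [this, hz, smul_mul_assoc, one_mul]

section Count

variable [FiniteDimensional k V] [Fintype G] [Invertible (Nat.card G : k)]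

/-- **The count.** If the character of `ρ` vanishes at every `g ≠ 1`, then `|G| · dim V^G = dim V` (as elements of
`k`): the Reynolds projector has trace `dim V / |G|`. Folklore. -/
theorem card_mul_finrank_invariants_eq (h0 : ∀ g : G, g ≠ 1 → ρ.character g = 0) :
    (Nat.card G : k) * (finrank k (invariants ρ) : k) = (finrank k V : k) := by
  have hsum : ∑ g : G, ρ.character g = (finrank k V : k) := by
    rw [Finset.sum_eq_single (1 : G) (fun g _ hg => h0 g hg) (fun h1 => absurd (Finset.mem_univ _) h1),
      Representation.char_one]
  have h := ρ.card_inv_mul_sum_char_eq_finrank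
  rw [hsum] at h
  have hc : (Nat.card G : k) ≠ 0 := (isUnit_of_invertible (Nat.card G : k)).ne_zero
  rw [← h, ← mul_assoc, mul_inv_cancel₀ hc, one_mul]

/-- The count in natural numbers, in characteristic `0`: `|G| · dim V^G = dim V`. Folklore. -/
theorem card_mul_finrank_invariants_eq_nat [CharZero k] (h0 : ∀ g : G, g ≠ 1 → ρ.character g = 0) :
    Nat.card G * finrank k (invariants ρ) = finrank k V := by
  have h := card_mul_finrank_invariants_eq ρ h0
  exact_mod_cast h

end Count

section Level

variable [FiniteDimensional k V] (K : Subgroup G) [Fintype K] [Invertible (Nat.card K : k)]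

/-- **Level-subgroup count (Stone–von Neumann–Mumford bookkeeping).** Let `K ≤ G` be a subgroup («level subgroup»)
such that every `x ∈ K`, `x ≠ 1`, has a partner `h ∈ G` with `ρ (h x h⁻¹) = ζ • ρ x` for some scalar `ζ ≠ 1` (in a
theta group: `ζ = e(x,h)`, available for every `x ≠ 0` by non-degeneracy of the commutator pairing). Then
`|K| · dim V^K = dim V` (as elements of `k`). With `V = H^{i(M)}(A,M)`, `dim V = |χ(M)|`, this is the invariant count
`|χ(M)| / |G|` of TRIAGE RULE TW / PLAN-W1-TW T-9. Folklore. -/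
theorem card_mul_finrank_invariants_comp_subtype_eq
    (hK : ∀ x : K, x ≠ 1 → ∃ h : G, ∃ ζ : k, ζ ≠ 1 ∧ ρ (h * x * h⁻¹) = ζ • ρ x) :
    (Nat.card K : k) * (finrank k (invariants (ρ.comp K.subtype)) : k) = (finrank k V : k) := by
  apply card_mul_finrank_invariants_eq (ρ.comp K.subtype)
  intro x hx
  obtain ⟨h, ζ, hζ, hz⟩ := hK x hx
  show Representation.character (ρ.comp K.subtype) x = 0
  have hchar : Representation.character (ρ.comp K.subtype) x = ρ.character (x : G) := rfl
  rw [hchar]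
  exact character_eq_zero_of_conj_eq_smul ρ hζ hz

/-- The level-subgroup count in natural numbers, in characteristic `0`. Folklore. -/
theorem card_mul_finrank_invariants_comp_subtype_eq_nat [CharZero k]
    (hK : ∀ x : K, x ≠ 1 → ∃ h : G, ∃ ζ : k, ζ ≠ 1 ∧ ρ (h * x * h⁻¹) = ζ • ρ x) :
    Nat.card K * finrank k (invariants (ρ.comp K.subtype)) = finrank k V := by
  have h := card_mul_finrank_invariants_comp_subtype_eq ρ K hK
  exact_mod_cast h

end Level

end HeisenbergCount

end Summit.Ventures.HSemireg

end
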